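import Literature.NumberTheory.EllipticCurves.TwoAdicImageSurjectivityModTwoProofs
import Summits.BirchSwinnertonDyer.BirchSwinnertonDyer.Theorems.AlignedTransportAtTwoMainConjectureOfRankZeroBSDAtTwoFineRoadQuadraticTwist
import Literature.NumberTheory.EllipticCurves.CyclotomicIwasawaMainTheoremIrreducibleBaseChangeProofs
import Literature.NumberTheory.EllipticCurves.NonvanishingTwistsHoffsteinLuo
import Literature.NumberTheory.EllipticCurves.LFunctionSmulProofs
import Literature.NumberTheory.EllipticCurves.AnalyticRankOrderProofs
import Literature.NumberTheory.EllipticCurves.BSDRootNumberNoContinuationProofs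
import Literature.NumberTheory.EllipticCurves.TwoPowerTorsion
import HarnessLib

/-!
# Route `ByReductionTypeAtTwo` (rung K4), crux C1″ `FineSelmerConjAAtTwoAdditivePotGood` (item stmt-BirchSwinnertonDyer-22615):
# CUBIC REALIZATION — the curve `y² = X³ + pX² + qX + r`, its `2`-torsion point `(β, 0)` with point field `ℚ(β)`, and a
# RANK-ZERO globally minimal twist model with the same `j`, `2`-division field and `2`-torsion (Hoffstein–Luo BY NAME)
# (a `--supports 22615` file; seat `bsd-2adic-k4-w1` GEN 3; kernel plumbing for the sibling `…CurveFreeHeart`)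

HONEST FRAMING (cell `bsd-2adic`, D-0036/D-0054): types-the-object-of; closes nothing; nothing booked; BSD is not proved by any
of this. §§1–3 are kernel-only; §4 is CONDITIONAL on Hoffstein–Luo BY NAME (`hHL`, a head of the support item 22619).

WHY. GEN 2 priced C1″ EXACTLY in the cubic currency: modulo {`hLim2`, `h416`, `hI`}, C1″ ⟺ Iwasawa's `μ₂ = 0` for the cubic
`2`-torsion point fields `ℚ(P_W)` of the SCOPE CURVES `W` (`…CubicHeart`). To make that price CURVE-FREE one must realise a
given cubic field `ℚ(β)` as `ℚ(P_W)` for a scope curve `W` (non-CM, `r_an = 0`, additive potentially good at `2`, `S₃` image,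
globally minimal). This file supplies the realisation machinery, for the explicit curve `E_β : y² = X³ + pX² + qX + r` cut out by
the minimal polynomial of `β`:

* §1 (any field, `char 0`): `c₄(E_β) = 16(p² − 3q)`, `Δ(E_β) = 16·disc(X³ + pX² + qX + r)` (Mathlib `Cubic.discr`), `E_β` elliptic iff
  `disc ≠ 0`, and **`j(E_β) = 256 (p² − 3q)³ / disc`**.
* §2 (any field `F`, `char 0`): for a root `β ∈ F̄`, `(β, 0)` is a NON-ZERO point of `E_β[2]` whose stabiliser in `Γ_F` is
  `Stab(β)`, so that **its point field `F̄^{Stab}` IS `F(β)`** (`fixedField_stabilizer_eq_adjoin_root`; Krull correspondence in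
  `F̄/F`) — the first kernel identification of the tree's abstract `2`-torsion point field with a concrete cubic field.
* §3 (over `ℚ`): an IRREDUCIBLE cubic leaves `E_β` without rational point of exact order `2`, `disc ∉ ℚ²` gives `Δ ∉ ℚ²`, hence
  (Dokchitser–Dokchitser (1)) **`ρ̄_{E_β,2}` is onto `S₃`**, i.e. (sibling `…Heart` §1) `ℚ(E_β[2])/ℚ` is NON-ABELIAN — C1″'s `S₃`
  binder. ROUTE-FREE: this file imports no `Theses` module.
* §4 (over `ℚ`, `hHL`): **every elliptic `E/ℚ` has a GLOBALLY MINIMAL model `W` of a quadratic twist `E^{(d)}` (`d ≡ 1 (8)`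
  squarefree, `L(E^{(d)}, 1) ≠ 0`) with `r_an(W) = 0`, `j(W) = j(E)`, `ℚ(W[2]) = ℚ(E[2])` and a `Γ_ℚ`-equivariant
  `W[2] ≃+ E[2]`** (`exists_isGloballyMinimal_twist_analyticRank_eq_zero`; tree: Silverman VIII.8.3 global minimal models,
  `analyticRank_smul`, `analyticRank_eq_zero_iff_holds`, the `…FineRoadQuadraticTwist` transport); stabilisers are preserved.

With the Literature window `ReductionAtTwoJValuationWindow` (`1 ≤ v₂ j ≤ 11 ⟹` additive potentially good at `2`; `v₂ j ∈
{1,2,5,7,8,9,10,11} ⟹` non-CM) the sibling `…CurveFreeHeart` concludes: C1″ ⟹ `μ₂(ℚ(β)^{cyc}) = 0` for every `S₃`-cubic `ℚ(β)`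
with a window generator, and «`μ₂ = 0` for all cubic fields» ⟹ C1″.

References: [SilvermanAEC2009] III.§1, III.2.3, VIII.§1, VIII.8 Cor. 8.3, X.5 Cor. 5.4; [DokchitserDokchitserMathZ2012] Thm. (1);
[HoffsteinLuo1997] Theorem; [BirchSwinnertonDyer1965] (analytic rank).
-/

set_option autoImplicit false
-- sibling precedent (`…FineSelmerConjAAtTwoAdditivePotGoodHeart.lean`): the directory name repeats the summit name
set_option linter.dupNamespace false

noncomputable section

open scoped Classical IntermediateField

namespace Summit.BirchSwinnertonDyer.BirchSwinnertonDyer.Theorems.AddKatoTwo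

open WeierstrassCurve Field Polynomial Literature.NumberTheory.EllipticCurves
  Literature.NumberTheory.GaloisRepresentations

/-! ## §1 The curve `y² = x³ + p x² + q x + r` -/

section CubicModel

universe u

variable {F : Type u} [Field F] (p q r : F)

/-- `c₄(y² = x³ + px² + qx + r) = 16 (p² − 3q)`. -/
theorem cubicModel_c₄ : (⟨0, p, 0, q, r⟩ : WeierstrassCurve F).c₄ = 16 * (p ^ 2 - 3 * q) := by
  simp only [WeierstrassCurve.c₄, WeierstrassCurve.b₂, WeierstrassCurve.b₄]; ring

/-- `Δ(y² = x³ + px² + qx + r) = 16 · disc(X³ + pX² + qX + r)`. -/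
theorem cubicModel_Δ : (⟨0, p, 0, q, r⟩ : WeierstrassCurve F).Δ = 16 * Cubic.discr ⟨1, p, q, r⟩ := by
  simp only [WeierstrassCurve.Δ, WeierstrassCurve.b₂, WeierstrassCurve.b₄, WeierstrassCurve.b₆,
    WeierstrassCurve.b₈, Cubic.discr]; ring

/-- `y² = x³ + px² + qx + r` is an elliptic curve iff `disc(X³ + pX² + qX + r) ≠ 0` (char `F ≠ 2`). -/
theorem isElliptic_cubicModel [CharZero F] (h : Cubic.discr ⟨1, p, q, r⟩ ≠ 0) :
    (⟨0, p, 0, q, r⟩ : WeierstrassCurve F).IsElliptic :=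
  ⟨by rw [isUnit_iff_ne_zero, cubicModel_Δ]; exact mul_ne_zero (by norm_num) h⟩

/-- `j(y² = x³ + px² + qx + r) = 256 (p² − 3q)³ / disc(X³ + pX² + qX + r)`. -/
theorem cubicModel_j [CharZero F] [(⟨0, p, 0, q, r⟩ : WeierstrassCurve F).IsElliptic] :
    (⟨0, p, 0, q, r⟩ : WeierstrassCurve F).j = 256 * (p ^ 2 - 3 * q) ^ 3 / Cubic.discr ⟨1, p, q, r⟩ := by
  set E : WeierstrassCurve F := ⟨0, p, 0, q, r⟩ with hE
  have hΔ : E.Δ ≠ 0 := E.isUnit_Δ.ne_zero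
  have hdisc : Cubic.discr ⟨1, p, q, r⟩ ≠ 0 := by
    intro h0; apply hΔ; rw [hE, cubicModel_Δ, h0, mul_zero]
  have h1 : E.j = E.c₄ ^ 3 / E.Δ := by
    rw [j, ← coe_Δ', Units.val_inv_eq_inv_val]; ring
  rw [h1, hE, cubicModel_c₄, cubicModel_Δ]
  field_simp
  ring

end CubicModel

/-! ## §2 The `2`-torsion point `(β, 0)` and its point field `F(β)` -/

section PointField

universe u

variable {F : Type u} [Field F]

/-- The `Γ_F`-action on an affine geometric point is coordinatewise (definitionally). -/
private theorem smul_some_eq_some (E : WeierstrassCurve F) (g : absoluteGaloisGroup F) {x y : AlgebraicClosure F}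
    (h : (E.baseChange (AlgebraicClosure F)).toAffine.Nonsingular x y) :
    ∃ h', @HSMul.hSMul (absoluteGaloisGroup F) (geomPoints E) (geomPoints E) instHSMul g (Affine.Point.some x y h) =
      Affine.Point.some (g • x) (g • y) h' :=
  ⟨_, rfl⟩

/-- Affine points with equal coordinates are equal (proof-irrelevant form). -/
private theorem some_eq_some_of_eq' {R : Type u} [CommRing R] {V : WeierstrassCurve R} {x y x' y' : R}
    (hx : x = x') (hy : y = y') (h : V.toAffine.Nonsingular x y) (h' : V.toAffine.Nonsingular x' y') :
    Affine.Point.some x y h = Affine.Point.some x' y' h' := by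
  subst hx hy; rfl

/-- **`F̄^{Stab_{Γ_F}(β)} = F(β)`** for every `β ∈ F̄` (`char F = 0`): Krull's Galois correspondence in `F̄/F` — the
stabiliser of `β` is `Γ_{F(β)}`. -/
theorem fixedField_stabilizer_eq_adjoin [CharZero F] (β : AlgebraicClosure F) :
    IntermediateField.fixedField (MulAction.stabilizer (absoluteGaloisGroup F) β) = IntermediateField.adjoin F {β} := by
  haveI : IsGalois F (AlgebraicClosure F) := {}
  apply le_antisymm
  · intro x hx
    rw [← InfiniteGalois.fixedField_fixingSubgroup (IntermediateField.adjoin F {β}), IntermediateField.mem_fixedField_iff]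
    intro τ hτ
    rw [IntermediateField.mem_fixedField_iff] at hx
    simp only [IntermediateField.mem_fixingSubgroup_iff] at hτ
    have hτβ : τ β = β := hτ β (IntermediateField.mem_adjoin_simple_self F β)
    have hmem : (absoluteGaloisGroup.toAlgEquiv F).symm τ ∈ MulAction.stabilizer (absoluteGaloisGroup F) β :=
      MulAction.mem_stabilizer_iff.mpr (by rw [absoluteGaloisGroup.toAlgEquiv_symm_apply]; exact hτβ)
    exact hx ((absoluteGaloisGroup.toAlgEquiv F).symm τ) hmem
  · rw [IntermediateField.adjoin_simple_le_iff, IntermediateField.mem_fixedField_iff]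
    intro τ hτ
    have h := MulAction.mem_stabilizer_iff.mp
      (show (absoluteGaloisGroup.toAlgEquiv F).symm τ ∈ MulAction.stabilizer (absoluteGaloisGroup F) β from hτ)
    rwa [absoluteGaloisGroup.toAlgEquiv_symm_apply] at h

variable [CharZero F] (p q r : F)

omit [CharZero F] in
/-- A root `β ∈ F̄` of `X³ + pX² + qX + r` gives the affine point `(β, 0)` of `y² = x³ + px² + qx + r` over `F̄`. -/
theorem nonsingular_cubicModel_root [(⟨0, p, 0, q, r⟩ : WeierstrassCurve F).IsElliptic] {β : AlgebraicClosure F}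
    (hβ : aeval β (Cubic.toPoly ⟨1, p, q, r⟩) = 0) :
    ((⟨0, p, 0, q, r⟩ : WeierstrassCurve F).baseChange (AlgebraicClosure F)).toAffine.Nonsingular β 0 := by
  rw [← Affine.equation_iff_nonsingular, Affine.equation_iff]
  simp only [Cubic.toPoly, map_one, one_mul, aeval_add, aeval_mul, aeval_C, aeval_X_pow, aeval_X] at hβ
  simp only [baseChange, map_a₁, map_a₂, map_a₃, map_a₄, map_a₆, map_zero]
  linear_combination -hβ

omit [CharZero F] in
/-- **The `2`-torsion point `P_β = (β, 0)` of `y² = x³ + px² + qx + r`** (`β` a root of the cubic in `F̄`): a NON-ZERO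
element of `E[2]` whose underlying geometric point is `(β, 0)`. -/
theorem exists_geomTorsion_two_eq_some_root [(⟨0, p, 0, q, r⟩ : WeierstrassCurve F).IsElliptic]
    {β : AlgebraicClosure F} (hβ : aeval β (Cubic.toPoly ⟨1, p, q, r⟩) = 0) :
    ∃ P : geomTorsion (⟨0, p, 0, q, r⟩ : WeierstrassCurve F) 2, P ≠ 0 ∧
      @Eq (geomPoints (⟨0, p, 0, q, r⟩ : WeierstrassCurve F)) P
        (Affine.Point.some β 0 (nonsingular_cubicModel_root p q r hβ)) := by
  have h2 : (2 : ℕ) • (show geomPoints (⟨0, p, 0, q, r⟩ : WeierstrassCurve F) from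
      Affine.Point.some β 0 (nonsingular_cubicModel_root p q r hβ)) = 0 := by
    refine (two_nsmul_some_eq_zero_iff_eq_negY _ (nonsingular_cubicModel_root p q r hβ)).mpr ?_
    simp [Affine.negY, baseChange]
  have hmem : (show geomPoints (⟨0, p, 0, q, r⟩ : WeierstrassCurve F) from
      Affine.Point.some β 0 (nonsingular_cubicModel_root p q r hβ)) ∈
        geomTorsion (⟨0, p, 0, q, r⟩ : WeierstrassCurve F) 2 := by
    change _ ∈ (Submodule.torsionBy ℤ _ (2 : ℤ)).toAddSubgroup
    rw [Submodule.mem_toAddSubgroup, Submodule.mem_torsionBy_iff, ofNat_zsmul]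
    exact h2
  refine ⟨⟨_, hmem⟩, fun h0 => ?_, rfl⟩
  exact Affine.Point.some_ne_zero _ (congrArg Subtype.val h0)

omit [CharZero F] in
/-- **`σ ∈ Γ_F` fixes `P_β = (β, 0)` iff `σ β = β`.** -/
theorem smul_eq_iff_smul_root_eq [(⟨0, p, 0, q, r⟩ : WeierstrassCurve F).IsElliptic]
    {β : AlgebraicClosure F} (hβ : aeval β (Cubic.toPoly ⟨1, p, q, r⟩) = 0)
    {P : geomTorsion (⟨0, p, 0, q, r⟩ : WeierstrassCurve F) 2}
    (hP : @Eq (geomPoints (⟨0, p, 0, q, r⟩ : WeierstrassCurve F)) P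
      (Affine.Point.some β 0 (nonsingular_cubicModel_root p q r hβ)))
    (σ : absoluteGaloisGroup F) : σ • P = P ↔ σ • β = β := by
  rw [Subtype.ext_iff, AddSubgroup.torsionBy.coe_smul, hP]
  obtain ⟨h', e⟩ := smul_some_eq_some (⟨0, p, 0, q, r⟩ : WeierstrassCurve F) σ (nonsingular_cubicModel_root p q r hβ)
  rw [e]
  constructor
  · intro h; exact (Affine.Point.some.inj h).1
  · intro h; exact some_eq_some_of_eq' h (smul_zero σ) h' _

omit [CharZero F] in
/-- **The stabiliser in `Γ_F` of `P_β = (β, 0)` is the stabiliser of `β`** (`= Γ_{F(β)}`). -/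
theorem stabilizer_eq_stabilizer_root [(⟨0, p, 0, q, r⟩ : WeierstrassCurve F).IsElliptic]
    {β : AlgebraicClosure F} (hβ : aeval β (Cubic.toPoly ⟨1, p, q, r⟩) = 0)
    {P : geomTorsion (⟨0, p, 0, q, r⟩ : WeierstrassCurve F) 2}
    (hP : @Eq (geomPoints (⟨0, p, 0, q, r⟩ : WeierstrassCurve F)) P
      (Affine.Point.some β 0 (nonsingular_cubicModel_root p q r hβ))) :
    MulAction.stabilizer (absoluteGaloisGroup F) P = MulAction.stabilizer (absoluteGaloisGroup F) β := by
  ext σ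
  rw [MulAction.mem_stabilizer_iff, MulAction.mem_stabilizer_iff, smul_eq_iff_smul_root_eq p q r hβ hP σ]

/-- **The point field of `P_β = (β, 0)` is `F(β)`**: `F̄^{Stab(P_β)} = F⟮β⟯`. -/
theorem fixedField_stabilizer_eq_adjoin_root [(⟨0, p, 0, q, r⟩ : WeierstrassCurve F).IsElliptic]
    {β : AlgebraicClosure F} (hβ : aeval β (Cubic.toPoly ⟨1, p, q, r⟩) = 0)
    {P : geomTorsion (⟨0, p, 0, q, r⟩ : WeierstrassCurve F) 2}
    (hP : @Eq (geomPoints (⟨0, p, 0, q, r⟩ : WeierstrassCurve F)) P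
      (Affine.Point.some β 0 (nonsingular_cubicModel_root p q r hβ))) :
    IntermediateField.fixedField (MulAction.stabilizer (absoluteGaloisGroup F) P) = IntermediateField.adjoin F {β} := by
  rw [stabilizer_eq_stabilizer_root p q r hβ hP, fixedField_stabilizer_eq_adjoin]

end PointField

/-! ## §3 Over `ℚ`: irreducible cubic ⟹ no rational `2`-torsion; `disc ∉ ℚ²` ⟹ `Δ ∉ ℚ²`; hence the `S₃` binder -/

section RatModel

variable (p q r : ℚ)

/-- **An IRREDUCIBLE cubic `X³ + pX² + qX + r` leaves `y² = x³ + px² + qx + r` without rational point of exact order `2`**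
(such a point is `(x, y)` with `x ∈ ℚ` a root of the `2`-division cubic `4x³ + b₂x² + 2b₄x + b₆ = 4(x³ + px² + qx + r)`). -/
theorem forall_two_nsmul_eq_zero_of_irreducible [(⟨0, p, 0, q, r⟩ : WeierstrassCurve ℚ).IsElliptic]
    (hirr : Irreducible (Cubic.toPoly ⟨1, p, q, r⟩)) :
    ∀ P : (⟨0, p, 0, q, r⟩ : WeierstrassCurve ℚ).toAffine.Point, 2 • P = 0 → P = 0 := by
  intro P h2
  cases P with
  | zero => rfl
  | @some x y h =>
    exfalso
    have hroot := ((⟨0, p, 0, q, r⟩ : WeierstrassCurve ℚ).two_nsmul_some_eq_zero_iff_isRoot_Ψ₂Sq h).mp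
      (by convert h2)
    have hroot' : (Cubic.toPoly ⟨1, p, q, r⟩).IsRoot x := by
      rw [IsRoot.def] at hroot ⊢
      simp only [Ψ₂Sq, WeierstrassCurve.b₂, WeierstrassCurve.b₄, WeierstrassCurve.b₆, eval_add, eval_mul, eval_C,
        eval_pow, eval_X] at hroot
      simp only [Cubic.toPoly, map_one, one_mul, eval_add, eval_mul, eval_C, eval_pow, eval_X]
      linear_combination hroot / 4
    have hdeg := Polynomial.degree_eq_one_of_irreducible_of_root hirr hroot'
    have h3 : (Cubic.toPoly ⟨1, p, q, r⟩).degree = 3 := Cubic.degree_of_a_ne_zero (by norm_num)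
    rw [hdeg] at h3
    exact absurd h3 (by decide)

/-- `disc(X³ + pX² + qX + r) ∉ ℚ² ⟹ Δ(y² = x³ + px² + qx + r) = 16·disc ∉ ℚ²`. -/
theorem not_isSquare_Δ_of_not_isSquare_discr (hsq : ¬ IsSquare (Cubic.discr ⟨1, p, q, r⟩)) :
    ¬ IsSquare (⟨0, p, 0, q, r⟩ : WeierstrassCurve ℚ).Δ := by
  rw [cubicModel_Δ]
  rintro ⟨s, hs⟩
  exact hsq ⟨s / 4, by linear_combination hs / 16⟩

/-- **`ρ̄_{E,2}` is ONTO `Aut(E[2]) ≅ S₃` for `y² = x³ + px² + qx + r`** when the cubic is irreducible over `ℚ` with NON-SQUARE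
discriminant (Dokchitser–Dokchitser (1), tree theorem `hasSurjectiveModNGaloisRep_two_iff`); equivalently (sibling `…Heart` §1)
`ℚ(E[2])/ℚ` is non-abelian — C1″'s `S₃` binder, kept here in the route-free `HasSurjectiveModNGaloisRep` currency.
[cite: DokchitserDokchitserMathZ2012, Theorem (1)] -/
theorem hasSurjectiveModNGaloisRep_two_of_irreducible_of_not_isSquare
    [(⟨0, p, 0, q, r⟩ : WeierstrassCurve ℚ).IsElliptic]
    (hirr : Irreducible (Cubic.toPoly ⟨1, p, q, r⟩)) (hsq : ¬ IsSquare (Cubic.discr ⟨1, p, q, r⟩)) :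
    (⟨0, p, 0, q, r⟩ : WeierstrassCurve ℚ).HasSurjectiveModNGaloisRep 2 :=
  (hasSurjectiveModNGaloisRep_two_iff _).mpr
    ⟨forall_two_nsmul_eq_zero_of_irreducible p q r hirr, not_isSquare_Δ_of_not_isSquare_discr p q r hsq⟩

end RatModel

/-! ## §4 REALIZATION: every `E/ℚ` has a globally minimal quadratic-twist model of analytic rank `0` with the SAME `j`,
the SAME `2`-division field and `Γ_ℚ`-isomorphic `2`-torsion (Hoffstein–Luo BY NAME) -/

section Realization

/-- `j` does not see the `IsElliptic` witness (congruence along an equality of equations). -/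
private theorem j_congr {V V' : WeierstrassCurve ℚ} [V.IsElliptic] [V'.IsElliptic] (h : V = V') : V.j = V'.j := by
  subst h; rfl

/-- `analyticRank` does not see the `IsElliptic` witness (congruence along an equality of equations). -/
private theorem analyticRank_congr {V V' : WeierstrassCurve ℚ} [V.IsElliptic] [V'.IsElliptic] (h : V = V') :
    V.analyticRank = V'.analyticRank := by
  subst h; rfl

/-- **Realization of an arbitrary `E/ℚ` as (a twist of) a RANK-ZERO curve with the same `2`-torsion**, granted
Hoffstein–Luo BY NAME (`hHL`): there is a GLOBALLY MINIMAL elliptic `W/ℚ` — a model of a quadratic twist `E^{(d)}`,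
`d ≡ 1 (mod 8)` squarefree with `L(E^{(d)}, 1) ≠ 0` — with `r_an(W) = 0`, `j(W) = j(E)`, `ℚ(W[2]) = ℚ(E[2])`, and a
`Γ_ℚ`-equivariant `W[2] ≃+ E[2]` (tree: `exists_isGloballyMinimal_smul_eq_quadraticTwist`, `analyticRank_smul`,
`analyticRank_eq_zero_iff_holds`, `divisionField_two_of_smul_eq_quadraticTwist`, `exists_torsionIso_two_of_smul_eq_quadraticTwist`).
[cite: HoffsteinLuo1997, Theorem] [cite: SilvermanAEC2009, VIII.8 Cor. 8.3 and X.5 Cor. 5.4] -/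
theorem exists_isGloballyMinimal_twist_analyticRank_eq_zero (hHL : HoffsteinLuo1997_exists_twist_L_one_ne_zero)
    (W₀ : WeierstrassCurve ℚ) [W₀.IsElliptic] :
    ∃ (W : WeierstrassCurve ℚ) (_ : W.IsElliptic) (_ : W.IsGloballyMinimal),
      W.analyticRank = 0 ∧ W.j = W₀.j ∧ W.divisionField 2 = W₀.divisionField 2 ∧
      ∃ e : W.geomTorsion 2 ≃+ W₀.geomTorsion 2,
        ∀ (σ : absoluteGaloisGroup ℚ) (P : W.geomTorsion 2), e (σ • P) = σ • e P := by
  obtain ⟨d, -, hsqf, -, -, -, hL⟩ := hHL W₀ ∅ 0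
  have hd : (d : ℚ) ≠ 0 := by exact_mod_cast hsqf.ne_zero
  obtain ⟨W, hWe, hWm, C, hC⟩ := exists_isGloballyMinimal_smul_eq_quadraticTwist W₀ hd
  haveI := W₀.isElliptic_quadraticTwist hd
  refine ⟨W, hWe, hWm, ?_, ?_, ?_, ?_⟩
  · have h0 : (W₀.quadraticTwist (d : ℚ)).analyticRank = 0 := by
      by_cases hE : (W₀.quadraticTwist (d : ℚ)).HasEntireLFunction
      · exact (analyticRank_eq_zero_iff_holds (W := W₀.quadraticTwist (d : ℚ)) hE).mpr hL
      · exact analyticRank_eq_zero_of_not_hasEntireLFunction _ hE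
    rw [← analyticRank_smul W C, analyticRank_congr hC, h0]
  · rw [← variableChange_j W C, j_congr hC, j_quadraticTwist W₀ hd]
  · exact AlignedTransportAtTwoFineRoad.QuadraticTwist.divisionField_two_of_smul_eq_quadraticTwist W₀ W hd hC
  · exact AlignedTransportAtTwoFineRoad.QuadraticTwist.exists_torsionIso_two_of_smul_eq_quadraticTwist W₀ W hd hC

/-- Equivariant isomorphisms preserve stabilisers: `Stab(P) = Stab(e P)`. -/
theorem stabilizer_eq_of_torsionIso {W W₀ : WeierstrassCurve ℚ} (e : W.geomTorsion 2 ≃+ W₀.geomTorsion 2)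
    (he : ∀ (σ : absoluteGaloisGroup ℚ) (P : W.geomTorsion 2), e (σ • P) = σ • e P) (P : W.geomTorsion 2) :
    MulAction.stabilizer (absoluteGaloisGroup ℚ) P = MulAction.stabilizer (absoluteGaloisGroup ℚ) (e P) := by
  ext σ
  simp only [MulAction.mem_stabilizer_iff]
  rw [← he, e.apply_eq_iff_eq]

end Realization

end Summit.BirchSwinnertonDyer.BirchSwinnertonDyer.Theorems.AddKatoTwo

end
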